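/-
Copyright (c) 2026. All rights reserved.
Released under Apache 2.0 license as described in the file LICENSE.
Authors: abc-iut cell, prover seat abc-iut-L4-t5 (gen 9), over the statements of abc-iut-L4-t3 and the `⊞`-side construction of
abc-iut-f-101 (`LogFrobeniusObservablesOfIotaSquare.lean`), of which this file is the `TS`-side analogue.
-/
import Literature.AnabelianGeometry.AbsoluteAnabelian.LogFrobeniusObservablesTSCoherence
import HarnessLib

/-!
# [AbsTopIII] Corollary 5.5 (iii), `TS`-half: the observable `S_log` CONSTRUCTED from the `TS` ι-diamond law — at EVERY place, for EVERY `TS`-datum; `S_log` exists wherever `S_log⊞` does (F-0142 ⇒ F-3080)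

S. Mochizuki, *Topics in absolute anabelian geometry III: global reconstruction algorithms*,
J. Math. Sci. Univ. Tokyo 22 (2015) 939–1156 [MochizukiAbsTopIII2015]; locators `p.N` = pages of the author's
manuscript (`paper:url-5493eb38cbb7`): Def 5.4 (iii) p. 126, (vii) p. 128 (the `TS`-valued `ι_{v,ε}` for every edge of
`Γ⃗^log_v`), Cor 5.5 (iii) p. 131 ("respectively, [the `ι_{v,ε}`] belong to a family of homotopies on `D•_{≤4}` that
determines … a structure of observable `S_log` on the portion of `D•_{≤3}` indexed by `v`"), proof p. 132 ("immediate from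
the definitions"), §0 p. 26 / Def 3.5 (ii)–(iii) pp. 75–76.

PROOF companion of abc-iut-L4-t3's `LogFrobeniusObservables.lean` (`LogFrobeniusSetting.IsLogObservableTS`,
`Cor55ObservablesTS` = FACT-LIST F-3080, an ASSUMPTION on `(L, T)` whose universal closure is refuted at degenerate data,
abc-iut-w5-d097 `not_forall_cor55ObservablesTS`), completing abc-iut-w5-d097's NECESSITY by the CONVERSE at every place —
archimedean or not — and for every `TS`-datum `T`, from the coherence theorem of `LogFrobeniusObservablesTSCoherence.lean`:

* `logObsFamilyTS` — the family of homotopies of `S_log` at `v` (toolkit `DiagramChainFamilies.chainFamily` of abc-iut-f-101: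
  boundary set = pairs of paths into `𝒩_v` joined by a chain of whiskered generator moves, homotopies = composites of
  whiskered `ι`'s — print's "immediate from the definitions" made explicit); `isLogObservableTS_logObsFamilyTS` — it IS an
  observable `S_log` as typed;
* `exists_isLogObservableTS_iff : (∃ H, L.IsLogObservableTS T v H) ↔ L.IotaSquaresCommuteTS T v` and
  `cor55ObservablesTS_iff_iotaSquaresCommuteTS` — F-3080 located EXACTLY over the interface;
* ★ `cor55ObservablesTS_of_cor55Observables : L.Cor55Observables → L.Cor55ObservablesTS T` — F-0142 ⇒ F-3080 for EVERY
  `TS`-datum: the observable `S_log` EXISTS WHEREVER `S_log⊞` DOES (the `TS`-only `ι_{v,k̄^×↪k̄}` is unconstrained).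

The archimedean places (where `Γ⃗^log_v = Γ⃗^⋉_v`) were settled before by abc-iut-w5-d053's push-forward along `𝒩⊞_v → 𝒩_v`
(`exists_isLogObservableTS_of_isArc`, `archGenuine_cor55ObservablesTS`, `LogFrobeniusObservablesTSOfPlus.lean`); the present
route is uniform and covers the NONARCHIMEDEAN places — the genuine nonarchimedean carriers are in the companion
`LogFrobeniusObservablesTSGenuine.lean`.  HONEST LABEL: this discharges the typed row F-3080 EXACTLY MODULO the named
interface-level law; no side is taken on which `(L, T)` satisfy it (print's genuine theaters do by Def 5.4 (iii)).  Refereed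
pre-IUT material; nothing here bears on [IUTchIII] Cor. 3.12; OUR kernel check, no side taken.
-/

set_option autoImplicit false

universe u

open CategoryTheory Quiver

namespace Literature.AnabelianGeometry.AbsoluteAnabelian

namespace LogFrobeniusSetting

variable {Vmod : Type u} {isArc : Vmod → Bool} (L : LogFrobeniusSetting Vmod isArc) (v : Vmod)
  (T : L.TSHomotopies)

/-! ## The observable `S_log` from the `TS` ι-diamond law -/

/-- `𝒩_v` has no outgoing arrow in the `TS`-shape. [cite: MochizukiAbsTopIII2015, Cor 5.5 (iii) p. 131] -/
theorem isEmpty_hom_logObsTS (b : (logShapeTS (isArc := isArc) v).Vertex) : IsEmpty ((logShapeTS v).obs ⟶ b) :=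
  DiagramOfCategories.ExtShape.isEmpty_hom_obs _ (fun _ => (inferInstance : IsEmpty PEmpty.{u + 1})) b

/-- **The family of homotopies of `S_log` at `v`**, CONSTRUCTED from the `TS` ι-diamond law: the family generated (toolkit
`chainFamily`) by the printed pairs with homotopies the `TS`-valued `ι_{v,ε}`, whiskered and composed.
[cite: MochizukiAbsTopIII2015, Cor 5.5 (iii) p. 131] -/
noncomputable def logObsFamilyTS (hsq : L.IotaSquaresCommuteTS T v) : (L.logDiagramTS v).HomotopyFamily :=
  DiagramOfCategories.chainFamily (L.logDiagramTS v) (LogGenTS v) (L.logGenHomTS v T) (logShapeTS v).obs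
    (isEmpty_hom_logObsTS v) (fun p q c c' => L.chain_hom_eq_TS v T hsq p q c c')

/-- Transport of a component of a natural transformation along an equality of objects. [folklore] -/
private theorem app_congr_objTS {A B : Type*} [Category A] [Category B] {F G : A ⥤ B} (α : F ⟶ G) {y y' : A}
    (hy : y = y') : α.app y = eqToHom (by rw [hy]) ≫ α.app y' ≫ eqToHom (by rw [hy]) := by
  subst hy
  simp

/-- `eqToHom` bookkeeping: a doubly conjugated morphism is singly conjugated. [folklore] -/
private theorem eqToHom_conj₃TS {C : Type*} [Category C] {a₀ a b c d e₁ e₂ e₃ : C} (o : a₀ = a) (p : a = b)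
    (q : b = c) (g : c ⟶ d) (r : d = e₁) (s' : e₁ = e₂) (s'' : e₂ = e₃) (t : a₀ = c) (u : d = e₃) :
    eqToHom o ≫ (eqToHom p ≫ (eqToHom q ≫ g ≫ eqToHom r) ≫ eqToHom s') ≫ eqToHom s'' = eqToHom t ≫ g ≫ eqToHom u := by
  subst o p q r s' s''
  simp

/-- **`S_log` IS an observable as typed** (`IsLogObservableTS`): all boundary paths end at `𝒩_v`, and the two printed kinds of
pairs are boundary pairs carrying exactly the `TS`-valued `ι_{v,ε}` (componentwise).
[cite: MochizukiAbsTopIII2015, Cor 5.5 (iii) p. 131] -/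
theorem isLogObservableTS_logObsFamilyTS (hsq : L.IotaSquaresCommuteTS T v) :
    L.IsLogObservableTS T v (L.logObsFamilyTS v T hsq) := by
  refine ⟨fun _ _ _ _ h => h.1, ?_, ?_⟩
  · intro ν₁ ν₂ ε h₁ h₂
    let s : LogGenTS v (lamPathTS v ν₁ h₁) (lamPathTS v ν₂ h₂) := LogGenTS.pre ν₁ ν₂ ε h₁ h₂
    refine ⟨DiagramOfCategories.chainFamily_mem _ _ _ _ _ _
      (DiagramOfCategories.Chain.cons ⟨_, Path.nil, _, _, s, (Path.nil_comp _).symm, (Path.nil_comp _).symm⟩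
        (DiagramOfCategories.Chain.nil _)), fun X₀ => ?_⟩
    obtain ⟨h', e, e', hη⟩ := DiagramOfCategories.chainFamily_η_gen (L.logDiagramTS v) (LogGenTS v) (L.logGenHomTS v T)
      (logShapeTS v).obs (isEmpty_hom_logObsTS v) (fun p q c c' => L.chain_hom_eq_TS v T hsq p q c c') s X₀
    refine ⟨Functor.congr_obj (L.pathFunctor_lamPathTS v ν₁ h₁) X₀,
      Functor.congr_obj (L.pathFunctor_lamPathTS' v ν₂ h₂) X₀, ?_⟩
    refine hη.trans ?_
    simp only [s, logGenHomTS, NatTrans.comp_app, eqToHom_app]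
    erw [app_congr_objTS (T.iota v ε) ((L.logDiagramTS v).pathFunctor_nil_obj
      ((logShapeTS (isArc := isArc) v).base ⟨.core, core_mem_portion v⟩) X₀)]
    exact eqToHom_conj₃TS (g := (T.iota v ε).app X₀) _ _ _ _ _ _ _ _
  · intro ν₁ ν₂ ε h₁ h₂ hsl n
    let s : LogGenTS v (postLogDomPathTS v n hsl) (postLogCodPathTS v n ν₂ h₂) := LogGenTS.post ν₁ ν₂ ε h₁ h₂ hsl n
    refine ⟨DiagramOfCategories.chainFamily_mem _ _ _ _ _ _
      (DiagramOfCategories.Chain.cons ⟨_, Path.nil, _, _, s, (Path.nil_comp _).symm, (Path.nil_comp _).symm⟩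
        (DiagramOfCategories.Chain.nil _)), fun X₀ => ?_⟩
    obtain ⟨h', e, e', hη⟩ := DiagramOfCategories.chainFamily_η_gen (L.logDiagramTS v) (LogGenTS v) (L.logGenHomTS v T)
      (logShapeTS v).obs (isEmpty_hom_logObsTS v) (fun p q c c' => L.chain_hom_eq_TS v T hsq p q c c') s X₀
    refine ⟨Functor.congr_obj (L.pathFunctor_postLogDomPathTS v ν₁ h₁ n hsl) X₀,
      Functor.congr_obj (L.pathFunctor_postLogCodPathTS v n ν₂ h₂) X₀, ?_⟩
    refine hη.trans ?_
    simp only [s, logGenHomTS, NatTrans.comp_app, eqToHom_app]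
    erw [app_congr_objTS (T.iota v ε) ((L.logDiagramTS v).pathFunctor_nil_obj
      ((logShapeTS (isArc := isArc) v).base ⟨.row1 (n + 1), row1_mem_portion v (n + 1)⟩) X₀)]
    exact eqToHom_conj₃TS (g := (T.iota v ε).app X₀) _ _ _ _ _ _ _ _

/-! ## F-3080 located exactly; `S_log` from `S_log⊞` -/

/-- **Cor 5.5 (iii), `TS`-half, located exactly at one place**: an observable `S_log` at `v` exists if and only if the `TS`
ι-diamond law holds at `v` (⟹ abc-iut-w5-d097; ⟸ the construction above). [cite: MochizukiAbsTopIII2015, Cor 5.5 (iii) p. 131] -/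
theorem exists_isLogObservableTS_iff :
    (∃ H : (L.logDiagramTS v).HomotopyFamily, L.IsLogObservableTS T v H) ↔ L.IotaSquaresCommuteTS T v :=
  ⟨fun ⟨H, hH⟩ => L.iotaSquaresCommuteTS_of_isLogObservableTS v T H hH,
    fun hsq => ⟨L.logObsFamilyTS v T hsq, L.isLogObservableTS_logObsFamilyTS v T hsq⟩⟩

/-- **F-3080 ⟺ the `TS` ι-diamond law at every place.** [cite: MochizukiAbsTopIII2015, Cor 5.5 (iii) p. 131] -/
theorem cor55ObservablesTS_iff_iotaSquaresCommuteTS : L.Cor55ObservablesTS T ↔ ∀ v, L.IotaSquaresCommuteTS T v :=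
  ⟨fun h v => (L.exists_isLogObservableTS_iff v T).mp (h v), fun h v => (L.exists_isLogObservableTS_iff v T).mpr (h v)⟩

/-- **`S_log` exists at `v` wherever `S_log⊞` does, for EVERY `TS`-datum** (the `⊞`-observable forces the `⊞`-square
condition — abc-iut-f-101 — which pushes down to the `TS` ι-diamond law). [cite: MochizukiAbsTopIII2015, Cor 5.5 (iii) p. 131] -/
theorem exists_isLogObservableTS_of_exists_isLogObservablePlus
    (h : ∃ H : (L.logDiagramPlus v).HomotopyFamily, L.IsLogObservablePlus v H) :
    ∃ H : (L.logDiagramTS v).HomotopyFamily, L.IsLogObservableTS T v H :=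
  (L.exists_isLogObservableTS_iff v T).mpr
    (L.iotaSquaresCommuteTS_of_iotaSquaresCommute v T ((L.exists_isLogObservablePlus_iff v).mp h))

/-- **F-0142 ⇒ F-3080 for EVERY `TS`-datum: the observable `S_log` of Cor 5.5 (iii) exists wherever `S_log⊞` does** (over the
interface, at every place of every setting; no side taken on which settings carry `S_log⊞` — print's genuine theaters do by
Def 5.4 (iii), abc-iut-f-101's `cor55Observables_iff_iotaSquaresCommute`). [cite: MochizukiAbsTopIII2015, Cor 5.5 (iii) p. 131] -/
theorem cor55ObservablesTS_of_cor55Observables (h : L.Cor55Observables) : L.Cor55ObservablesTS T :=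
  fun v => L.exists_isLogObservableTS_of_exists_isLogObservablePlus v T (h v)

/-- … equivalently, from the `⊞`-square condition at every place. [cite: MochizukiAbsTopIII2015, Cor 5.5 (iii) p. 131] -/
theorem cor55ObservablesTS_of_iotaSquaresCommute (hsq : ∀ v, L.IotaSquaresCommute v) : L.Cor55ObservablesTS T :=
  L.cor55ObservablesTS_of_cor55Observables T (L.cor55Observables_of_iotaSquaresCommute hsq)

end LogFrobeniusSetting

end Literature.AnabelianGeometry.AbsoluteAnabelian
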